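import Literature.Analysis.Fourier.PaleyWienerHalfPlane
import Summits.RiemannHypothesis.RiemannHypothesis.Theorems.SpectralTraceWindowTraceArchStubCausalCrystallisationAux
import HarnessLib

/-!
# Causal crystallisation — auxiliary file 2: the alias pairings vanish (contour argument)

Helper file for the stub `stub_causalCrystallisation` of the line `causal-level-sets` for the
crux `WindowTraceArch` (stmt-RiemannHypothesis-11195; skeleton
`Summit.RiemannHypothesis.RiemannHypothesis.Cruxes.WindowTraceArch.CausalLevelSets`; the stub is
proved in `Theorems/SpectralTraceWindowTraceArchStubCausalCrystallisation.lean`).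

* `causalCLS_integral_eq_zero_of_holo` : if `G` is holomorphic on `Im z > -δ` (`δ > 0`) with
  `‖G(x+iy)‖ ≤ C e^{-κy}/(1+x²)` for `y ≥ 0` (`κ > 0`), then `∫_ℝ G = 0`. The tilted function
  `e^{-iκz}G` is bounded by `C/(1+x²)` on the upper half-plane, so by the tree's half-plane
  Paley–Wiener lemma `Literature.Analysis.Fourier.fourier_upperSlice_eq_zero_of_neg` (Cauchy–Goursat
  on long rectangles, top side pushed to `+i∞`) its slices have Fourier transform vanishing on
  `ξ < 0`; at `ξ = -κ/2π` this says `∫ G(x+iy) dx = 0` for every `y > 0`, and `y → 0⁺` by dominated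
  convergence.
* `causalCLS_alias_upper` (registered sub-goal) / `causalCLS_alias_lower` : for a Hermite–Biehler
  `E` zero-free on `Im z ≥ -δ`, `0 ≤ L`, `A < 2L`, a Weil test `k` supported in `[-A, A]` and
  `n ≥ 1`, `∫ k̂(t) (e^{2iLt} E♯/E)^n dt = 0` and `∫ k̂(t) (e^{-2iLt} E/E♯)^n dt = 0`
  (`k̂(t) = weilMellin k (1/2 + it)`): `|E♯/E| ≤ 1` on the closed upper half-plane,
  `|e^{2iLz}| = e^{-2Ly}`, `|k̂(x+iy)| ≤ C e^{A|y|}/(1+x²)` (`causalCLS_weilMellin_offline`), and the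
  mirror statement in the lower half-plane after `z ↦ -z`.

**Sources.** Standard complex analysis (Cauchy–Goursat, Paley–Wiener growth of transforms of
compactly supported functions); L. de Branges, *Hilbert Spaces of Entire Functions* (1968), §19
(`|E♯/E| ≤ 1` on the upper half-plane). All statements are folklore.
-/

set_option linter.dupNamespace false

noncomputable section

open Complex Set MeasureTheory Filter
open scoped Real Topology ComplexConjugate FourierTransform

namespace Summit.RiemannHypothesis.RiemannHypothesis.Theorems.SpectralTraceWindowTraceArch

open Literature.NumberTheory.LFunctions
open Literature.Analysis.DeBrangesSpaces (IsHermiteBiehler sharp)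

/-! ### Pairings against boundary values of decaying holomorphic functions vanish -/

/-- Horizontal slices `x ↦ G(x + iy)` of a function holomorphic on `Im z > -δ` are continuous for
`y > -δ`. -/
theorem causalCLS_continuous_slice {G : ℂ → ℂ} {δ : ℝ}
    (hd : ∀ z : ℂ, -δ < z.im → DifferentiableAt ℂ G z) {y : ℝ} (hy : -δ < y) :
    Continuous fun x : ℝ => G ((x : ℂ) + (y : ℂ) * I) := by
  refine continuous_iff_continuousAt.2 fun x => ?_
  have h1 : ContinuousAt G ((x : ℂ) + (y : ℂ) * I) := (hd _ (by simpa using hy)).continuousAt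
  have h2 : ContinuousAt (fun x : ℝ => (x : ℂ) + (y : ℂ) * I) x := by fun_prop
  exact ContinuousAt.comp_of_eq h1 h2 rfl

/-- **Vanishing pairing.** Let `G` be holomorphic on the half-plane `Im z > -δ` (`δ > 0`) with
`‖G(x+iy)‖ ≤ C e^{-κy}/(1+x²)` for all `y ≥ 0` (`κ > 0`). Then `∫_ℝ G(x) dx = 0`: the slices of
the tilted function `e^{-iκz} G(z)` (bounded by `C/(1+x²)` on the upper half-plane) have Fourier
transform vanishing on the negative half-line
(`Literature.Analysis.Fourier.fourier_upperSlice_eq_zero_of_neg`, a rectangle-contour argument),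
which at the frequency `-κ/2π` says `∫ G(x+iy) dx = 0` for every `y > 0`; let `y → 0⁺` by
dominated convergence. -/
theorem causalCLS_integral_eq_zero_of_holo {G : ℂ → ℂ} {δ C κ : ℝ} (hδ : 0 < δ) (hκ : 0 < κ)
    (hd : ∀ z : ℂ, -δ < z.im → DifferentiableAt ℂ G z)
    (hb : ∀ x y : ℝ, 0 ≤ y → ‖G ((x : ℂ) + (y : ℂ) * I)‖ ≤ C * Real.exp (-(κ * y)) / (1 + x ^ 2)) :
    ∫ x : ℝ, G x = 0 := by
  have hC : 0 ≤ C := by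
    have h := (norm_nonneg _).trans (hb 0 0 le_rfl)
    simpa using h
  -- Step 1: the tilted function `G₁(z) = e^{-iκz} G(z)` is bounded by `C/(1+x²)` on `Im z > 0`
  set G₁ : ℂ → ℂ := fun z => cexp (-(I * κ * z)) * G z with hG₁
  have hd₁ : ∀ z : ℂ, 0 < z.im → DifferentiableAt ℂ G₁ z := fun z hz =>
    ((differentiableAt_id.const_mul (I * κ)).neg.cexp).mul (hd z (by linarith))
  have hnorm₁ : ∀ x y : ℝ, ‖cexp (-(I * κ * ((x : ℂ) + (y : ℂ) * I)))‖ = Real.exp (κ * y) := by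
    intro x y
    rw [Complex.norm_exp]
    congr 1
    simp only [neg_re, mul_re, mul_im, I_re, I_im, ofReal_re, ofReal_im, add_re, add_im]
    ring
  have hb₁ : ∀ x y : ℝ, 0 < y → ‖G₁ ((x : ℂ) + (y : ℂ) * I)‖ ≤ C * (1 + y) ^ 0 / (1 + x ^ 2) := by
    intro x y hy
    simp only [hG₁]
    rw [norm_mul, hnorm₁, pow_zero, mul_one]
    calc Real.exp (κ * y) * ‖G ((x : ℂ) + (y : ℂ) * I)‖
        ≤ Real.exp (κ * y) * (C * Real.exp (-(κ * y)) / (1 + x ^ 2)) :=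
          mul_le_mul_of_nonneg_left (hb x y hy.le) (Real.exp_pos _).le
      _ = C / (1 + x ^ 2) := by
          rw [Real.exp_neg]
          field_simp
  -- Step 2: every slice above the axis integrates to zero
  have hslice : ∀ y : ℝ, 0 < y → ∫ x : ℝ, G ((x : ℂ) + (y : ℂ) * I) = 0 := by
    intro y hy
    have hξ : -(κ / (2 * π)) < 0 := by
      have := Real.pi_pos
      exact neg_neg_of_pos (by positivity)
    have h := Literature.Analysis.Fourier.fourier_upperSlice_eq_zero_of_neg hd₁ hb₁ hy hξ
    rw [Real.fourier_real_eq_integral_exp_smul] at h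
    have e : ∀ v : ℝ, cexp (((-2 * π * v * (-(κ / (2 * π))) : ℝ) : ℂ) * I) •
        G₁ ((v : ℂ) + (y : ℂ) * I) = ((Real.exp (κ * y) : ℝ) : ℂ) * G ((v : ℂ) + (y : ℂ) * I) := by
      intro v
      simp only [hG₁, smul_eq_mul]
      rw [← mul_assoc, ← Complex.exp_add]
      congr 1
      have hv : (-2 * π * v * (-(κ / (2 * π)))) = κ * v := by
        field_simp
      rw [hv, Complex.ofReal_exp]
      congr 1
      push_cast
      ring_nf
      rw [I_sq]
      ring
    simp_rw [e] at h
    rw [integral_const_mul] at h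
    exact (mul_eq_zero.1 h).resolve_left (Complex.ofReal_ne_zero.2 (Real.exp_pos _).ne')
  -- Step 3: let `y → 0⁺` (dominated convergence with the majorant `C/(1+x²)`)
  have hlim : Tendsto (fun y : ℝ => ∫ x : ℝ, G ((x : ℂ) + (y : ℂ) * I)) (𝓝[>] 0)
      (𝓝 (∫ x : ℝ, G ((x : ℂ) + ((0 : ℝ) : ℂ) * I))) := by
    refine tendsto_integral_filter_of_dominated_convergence (fun x => C * (1 + x ^ 2)⁻¹)
      ?_ ?_ ?_ ?_
    · filter_upwards [self_mem_nhdsWithin] with y hy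
      exact (causalCLS_continuous_slice hd (by linarith [mem_Ioi.1 hy])).aestronglyMeasurable
    · filter_upwards [self_mem_nhdsWithin] with y hy
      refine Eventually.of_forall fun x => (hb x y (le_of_lt hy)).trans ?_
      rw [div_eq_mul_inv]
      refine mul_le_mul_of_nonneg_right ?_ (by positivity)
      have : Real.exp (-(κ * y)) ≤ 1 := Real.exp_le_one_iff.2 (by nlinarith [mem_Ioi.1 hy])
      nlinarith
    · exact integrable_inv_one_add_sq.const_mul C
    · refine Eventually.of_forall fun x => ?_
      have h1 : ContinuousAt G ((x : ℂ) + ((0 : ℝ) : ℂ) * I) := (hd _ (by simpa using hδ)).continuousAt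
      have h2 : Continuous fun y : ℝ => (x : ℂ) + (y : ℂ) * I := by fun_prop
      have h3 : ContinuousAt (fun y : ℝ => G ((x : ℂ) + (y : ℂ) * I)) 0 :=
        ContinuousAt.comp_of_eq h1 (h2.continuousAt (x := 0)) rfl
      exact h3.tendsto.mono_left nhdsWithin_le_nhds
  have hlim0 : Tendsto (fun y : ℝ => ∫ x : ℝ, G ((x : ℂ) + (y : ℂ) * I)) (𝓝[>] 0) (𝓝 0) := by
    refine tendsto_const_nhds.congr' ?_
    filter_upwards [self_mem_nhdsWithin] with y hy
    exact (hslice y hy).symm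
  have h := tendsto_nhds_unique hlim hlim0
  simpa using h

/-! ### The alias terms vanish -/

/-- `‖E♯(z)/E(z)‖ ≤ 1` on the closed upper half-plane for a Hermite–Biehler `E`. -/
theorem causalCLS_norm_sharp_div_le {E : ℂ → ℂ} (hE : IsHermiteBiehler E) {z : ℂ} (hz : 0 ≤ z.im) :
    ‖sharp E z / E z‖ ≤ 1 := by
  rw [norm_div, Literature.Analysis.DeBrangesSpaces.norm_sharp]
  refine div_le_one_of_le₀ ?_ (norm_nonneg _)
  rcases hz.lt_or_eq with hz' | hz'
  · exact (hE.norm_conj_lt _ hz').le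
  · have : conj z = z := Complex.conj_eq_iff_im.2 hz'.symm
    rw [this]

/-- `‖E(w)/E♯(w)‖ ≤ 1` on the closed lower half-plane for a Hermite–Biehler `E`. -/
theorem causalCLS_norm_div_sharp_le {E : ℂ → ℂ} (hE : IsHermiteBiehler E) {w : ℂ} (hw : w.im ≤ 0) :
    ‖E w / sharp E w‖ ≤ 1 := by
  rw [norm_div, Literature.Analysis.DeBrangesSpaces.norm_sharp]
  refine div_le_one_of_le₀ ?_ (norm_nonneg _)
  rcases hw.lt_or_eq with hw' | hw'
  · have h1 : 0 < (conj w).im := by rw [Complex.conj_im]; linarith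
    have h2 := hE.norm_conj_lt _ h1
    rw [Complex.conj_conj] at h2
    exact h2.le
  · have : conj w = w := Complex.conj_eq_iff_im.2 hw'
    rw [this]

/-- **The upper alias terms vanish.** For a Hermite–Biehler `E` without zeros on `Im z ≥ -δ`, a
tilt `L ≥ 0`, a window `A < 2L`, a Weil test `k` supported in `[-A, A]` and `n ≥ 1`:
`∫ k̂(t) (e^{2iLt} E♯(t)/E(t))ⁿ dt = 0` — the integrand extends holomorphically to `Im z > -δ`
with the bound `C e^{-(2L-A)y}/(1+x²)` on the upper half-plane (`|E♯/E| ≤ 1` there,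
`|e^{2iLz}| = e^{-2Ly}`, `|k̂(x+iy)| ≤ C e^{Ay}/(1+x²)`), so `causalCLS_integral_eq_zero_of_holo`
applies. -/
theorem causalCLS_alias_upper :
    ∀ (E : ℂ → ℂ) (δ L A : ℝ) (k : ℝ → ℂ) (n : ℕ), IsHermiteBiehler E → 0 < δ →
      (∀ z : ℂ, -δ ≤ z.im → E z ≠ 0) → 0 ≤ L → A < 2 * L → IsWeilTest k →
      tsupport k ⊆ Icc (-A) A → 1 ≤ n →
      ∫ t : ℝ, weilMellin k (1 / 2 + (t : ℂ) * I) *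
        (cexp (2 * (L : ℂ) * (t : ℂ) * I) * (sharp E t / E t)) ^ n = 0 := by
  intro E δ L A k n hE hδ h0 hL hAL hk hkA hn
  set G : ℂ → ℂ := fun z => weilMellin k (1 / 2 + z * I) *
    (cexp (2 * (L : ℂ) * z * I) * (sharp E z / E z)) ^ n with hG
  have hd : ∀ z : ℂ, -δ < z.im → DifferentiableAt ℂ G z := by
    intro z hz
    have h1 : DifferentiableAt ℂ (fun z : ℂ => weilMellin k (1 / 2 + z * I)) z :=
      ((differentiable_weilMellin hk.1.continuous hk.2).comp
        (by fun_prop : Differentiable ℂ fun z : ℂ => 1 / 2 + z * I)) z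
    have h2 : DifferentiableAt ℂ (fun z : ℂ => cexp (2 * (L : ℂ) * z * I)) z := by fun_prop
    have h3 : DifferentiableAt ℂ (sharp E) z :=
      Literature.Analysis.DeBrangesSpaces.differentiable_sharp hE.differentiable z
    have h4 : DifferentiableAt ℂ E z := hE.differentiable z
    exact h1.mul ((h2.mul (h3.div h4 (h0 z hz.le))).pow n)
  have hW := weilDecayW_nonneg 0 k
  have hb : ∀ x y : ℝ, 0 ≤ y → ‖G ((x : ℂ) + (y : ℂ) * I)‖ ≤
      weilDecayW 0 k * Real.exp (-((2 * L - A) * y)) / (1 + x ^ 2) := by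
    intro x y hy
    have hs : |((1 : ℂ) / 2 + ((x : ℂ) + (y : ℂ) * I) * I).re - 1 / 2| ≤ y := by
      have : ((1 : ℂ) / 2 + ((x : ℂ) + (y : ℂ) * I) * I).re - 1 / 2 = -y := by
        simp
      rw [this, abs_neg, abs_of_nonneg hy]
    have hK := causalCLS_weilMellin_offline _ _ _ _ hk hkA hy hs
    have him : ((1 : ℂ) / 2 + ((x : ℂ) + (y : ℂ) * I) * I).im = x := by simp
    rw [him] at hK
    have hexp : ‖cexp (2 * (L : ℂ) * ((x : ℂ) + (y : ℂ) * I) * I)‖ = Real.exp (-(2 * L * y)) := by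
      rw [Complex.norm_exp]
      congr 1
      simp only [mul_re, mul_im, I_re, I_im, ofReal_re, ofReal_im, add_re, add_im, re_ofNat,
        im_ofNat]
      ring
    have hΘ : ‖sharp E ((x : ℂ) + (y : ℂ) * I) / E ((x : ℂ) + (y : ℂ) * I)‖ ≤ 1 :=
      causalCLS_norm_sharp_div_le hE (by simpa using hy)
    have hprod : ‖(cexp (2 * (L : ℂ) * ((x : ℂ) + (y : ℂ) * I) * I) *
        (sharp E ((x : ℂ) + (y : ℂ) * I) / E ((x : ℂ) + (y : ℂ) * I))) ^ n‖ ≤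
        Real.exp (-(2 * L * y)) := by
      rw [norm_pow, norm_mul, hexp]
      have h1 : Real.exp (-(2 * L * y)) *
          ‖sharp E ((x : ℂ) + (y : ℂ) * I) / E ((x : ℂ) + (y : ℂ) * I)‖ ≤ Real.exp (-(2 * L * y)) :=
        mul_le_of_le_one_right (Real.exp_pos _).le hΘ
      have h2 : Real.exp (-(2 * L * y)) ≤ 1 := Real.exp_le_one_iff.2 (by nlinarith)
      calc (Real.exp (-(2 * L * y)) *
            ‖sharp E ((x : ℂ) + (y : ℂ) * I) / E ((x : ℂ) + (y : ℂ) * I)‖) ^ n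
          ≤ (Real.exp (-(2 * L * y))) ^ n := pow_le_pow_left₀ (by positivity) h1 n
        _ ≤ (Real.exp (-(2 * L * y))) ^ 1 := pow_le_pow_of_le_one (Real.exp_pos _).le h2 hn
        _ = Real.exp (-(2 * L * y)) := pow_one _
    calc ‖G ((x : ℂ) + (y : ℂ) * I)‖
        = ‖weilMellin k (1 / 2 + ((x : ℂ) + (y : ℂ) * I) * I)‖ *
            ‖(cexp (2 * (L : ℂ) * ((x : ℂ) + (y : ℂ) * I) * I) *
              (sharp E ((x : ℂ) + (y : ℂ) * I) / E ((x : ℂ) + (y : ℂ) * I))) ^ n‖ := norm_mul _ _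
      _ ≤ (Real.exp (A * y) * weilDecayW 0 k / (1 + x ^ 2)) * Real.exp (-(2 * L * y)) :=
          mul_le_mul hK hprod (norm_nonneg _) (by positivity)
      _ = weilDecayW 0 k * Real.exp (-((2 * L - A) * y)) / (1 + x ^ 2) := by
          rw [show -((2 * L - A) * y) = A * y + -(2 * L * y) by ring, Real.exp_add]
          ring
  exact causalCLS_integral_eq_zero_of_holo hδ (by linarith : 0 < 2 * L - A) hd hb

/-- **The lower alias terms vanish.** Same data as `causalCLS_alias_upper`:
`∫ k̂(t) (e^{-2iLt} E(t)/E♯(t))ⁿ dt = 0` — the integrand extends holomorphically to `Im z < δ`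
with the bound `C e^{-(2L-A)|y|}/(1+x²)` on the lower half-plane; reflect `z ↦ -z` and apply
`causalCLS_integral_eq_zero_of_holo`. -/
theorem causalCLS_alias_lower {E : ℂ → ℂ} (hE : IsHermiteBiehler E) {δ : ℝ} (hδ : 0 < δ)
    (h0 : ∀ z : ℂ, -δ ≤ z.im → E z ≠ 0) {L A : ℝ} (hL : 0 ≤ L) (hAL : A < 2 * L)
    {k : ℝ → ℂ} (hk : IsWeilTest k) (hkA : tsupport k ⊆ Icc (-A) A) {n : ℕ} (hn : 1 ≤ n) :
    ∫ t : ℝ, weilMellin k (1 / 2 + (t : ℂ) * I) *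
      (cexp (-(2 * (L : ℂ) * (t : ℂ) * I)) * (E t / sharp E t)) ^ n = 0 := by
  set H : ℂ → ℂ := fun z => weilMellin k (1 / 2 + z * I) *
    (cexp (-(2 * (L : ℂ) * z * I)) * (E z / sharp E z)) ^ n with hH
  set G : ℂ → ℂ := fun z => H (-z) with hG
  have hsharp_ne : ∀ w : ℂ, w.im ≤ δ → sharp E w ≠ 0 := by
    intro w hw
    rw [Literature.Analysis.DeBrangesSpaces.sharp_apply, map_ne_zero]
    exact h0 _ (by rw [Complex.conj_im]; linarith)
  have hd : ∀ z : ℂ, -δ < z.im → DifferentiableAt ℂ G z := by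
    intro z hz
    have h1 : DifferentiableAt ℂ (fun z : ℂ => weilMellin k (1 / 2 + z * I)) (-z) :=
      ((differentiable_weilMellin hk.1.continuous hk.2).comp
        (by fun_prop : Differentiable ℂ fun z : ℂ => 1 / 2 + z * I)) (-z)
    have h2 : DifferentiableAt ℂ (fun z : ℂ => cexp (-(2 * (L : ℂ) * z * I))) (-z) := by fun_prop
    have h3 : DifferentiableAt ℂ (sharp E) (-z) :=
      Literature.Analysis.DeBrangesSpaces.differentiable_sharp hE.differentiable (-z)
    have h4 : DifferentiableAt ℂ E (-z) := hE.differentiable (-z)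
    have hHd : DifferentiableAt ℂ H (-z) :=
      h1.mul ((h2.mul (h4.div h3 (hsharp_ne _ (by rw [Complex.neg_im]; linarith)))).pow n)
    exact hHd.comp z differentiable_neg.differentiableAt
  have hW := weilDecayW_nonneg 0 k
  have hb : ∀ x y : ℝ, 0 ≤ y → ‖G ((x : ℂ) + (y : ℂ) * I)‖ ≤
      weilDecayW 0 k * Real.exp (-((2 * L - A) * y)) / (1 + x ^ 2) := by
    intro x y hy
    set w : ℂ := -((x : ℂ) + (y : ℂ) * I) with hw
    have hwim : w.im = -y := by simp [hw]
    have hs : |((1 : ℂ) / 2 + w * I).re - 1 / 2| ≤ y := by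
      have : ((1 : ℂ) / 2 + w * I).re - 1 / 2 = y := by
        simp [hw]
      rw [this, abs_of_nonneg hy]
    have hK := causalCLS_weilMellin_offline _ _ _ _ hk hkA hy hs
    have him : ((1 : ℂ) / 2 + w * I).im = -x := by simp [hw]
    rw [him, neg_sq] at hK
    have hexp : ‖cexp (-(2 * (L : ℂ) * w * I))‖ = Real.exp (-(2 * L * y)) := by
      rw [Complex.norm_exp]
      congr 1
      simp only [hw, neg_re, mul_re, mul_im, I_re, I_im, ofReal_re, ofReal_im, add_re, add_im,
        re_ofNat, im_ofNat, neg_im]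
      ring
    have hΘ : ‖E w / sharp E w‖ ≤ 1 := causalCLS_norm_div_sharp_le hE (by rw [hwim]; linarith)
    have hprod : ‖(cexp (-(2 * (L : ℂ) * w * I)) * (E w / sharp E w)) ^ n‖ ≤
        Real.exp (-(2 * L * y)) := by
      rw [norm_pow, norm_mul, hexp]
      have h1 : Real.exp (-(2 * L * y)) * ‖E w / sharp E w‖ ≤ Real.exp (-(2 * L * y)) :=
        mul_le_of_le_one_right (Real.exp_pos _).le hΘ
      have h2 : Real.exp (-(2 * L * y)) ≤ 1 := Real.exp_le_one_iff.2 (by nlinarith)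
      calc (Real.exp (-(2 * L * y)) * ‖E w / sharp E w‖) ^ n
          ≤ (Real.exp (-(2 * L * y))) ^ n := pow_le_pow_left₀ (by positivity) h1 n
        _ ≤ (Real.exp (-(2 * L * y))) ^ 1 := pow_le_pow_of_le_one (Real.exp_pos _).le h2 hn
        _ = Real.exp (-(2 * L * y)) := pow_one _
    calc ‖G ((x : ℂ) + (y : ℂ) * I)‖
        = ‖weilMellin k (1 / 2 + w * I)‖ *
            ‖(cexp (-(2 * (L : ℂ) * w * I)) * (E w / sharp E w)) ^ n‖ := norm_mul _ _
      _ ≤ (Real.exp (A * y) * weilDecayW 0 k / (1 + x ^ 2)) * Real.exp (-(2 * L * y)) :=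
          mul_le_mul hK hprod (norm_nonneg _) (by positivity)
      _ = weilDecayW 0 k * Real.exp (-((2 * L - A) * y)) / (1 + x ^ 2) := by
          rw [show -((2 * L - A) * y) = A * y + -(2 * L * y) by ring, Real.exp_add]
          ring
  have h := causalCLS_integral_eq_zero_of_holo hδ (by linarith : 0 < 2 * L - A) hd hb
  have e : (fun x : ℝ => G x) = fun x : ℝ => (fun t : ℝ => H t) (-x) := by
    funext x
    simp only [hG, Complex.ofReal_neg]
  have h2 : ∫ x : ℝ, (fun t : ℝ => H t) (-x) = ∫ x : ℝ, (fun t : ℝ => H t) x :=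
    integral_neg_eq_self (fun t : ℝ => H t) volume
  rw [e, h2] at h
  exact h

end Summit.RiemannHypothesis.RiemannHypothesis.Theorems.SpectralTraceWindowTraceArch

end
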